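/-
Copyright: public-domain mathematics; typed transcription for the H21 Literature library (cell lit-balaban,
Phase-2 proof seat p16 gen 6 = literature-prover-lit-balaban-p16-g6-0).

statement-level skeleton of published theorems with citation tags; proofs where landed; nothing here is a claim about the Yang–Mills mass gap

# Bałaban, *Propagators and renormalization transformations for lattice gauge theories. I*,
# Commun. Math. Phys. **95** (1984) 17–40 — (1.126) `|(∂P∂*)_{μν}(x,x′)| ≤ O(1)e^{−δ′₀|x−x′|}` FOR r02's TYPED TORUS OPERATOR
# `GradOp·PcT·GradOpᴴ` (the `∂P∂*` block of `Δ_a = B5DeltaA169.DeltaA`), from b05's `B5DPD126Uniform` (the P-bridge, step (c))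

[cite: Balaban1984PropagatorsI]  T. Bałaban, Commun. Math. Phys. 95 (1984) 17–40.  (1.120) p. 37 (the `η`-weighted kernel of an
operator on `T_η`); p. 38 ll. 7–10 «P = G′Q′*(Q′G′²Q′*)⁻¹Q′G′ … We obtain |(∂P∂*)_{μ,ν}(x, x′)| ≦ O(1)e^{−δ′₀|x−x′|} (1.126) … The
constant O(1) in (1.126) depends on d only»; p. 30 ll. 7–9 «Δ_a is a positive operator. Of course it is a symmetric operator and it
is non-negative as a sum of two non-negative operators Δ − ∂P∂* and aQ*Q, a > 0» (the `∂P∂*` block of `Δ_a`; typed as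
`B5DeltaA169.DeltaA n M a = Lap − GradOp·PcT·GradOpᴴ + a•(QvAdj*QvOp)`).

WHAT THIS MODULE ADDS (SKELETON row B5.Prop1.2 census (vii) / r02 DESIGN-MEMO step (c); rows B5.Eq1.126/1.127 dictionary):
* `torIdx_add_unitVec` (`chart(x + e_μ) = fup μ (chart x)`), **`liftC_Dmat`**: b05's `Dmat n (nM) μ`, transported, IS r02's `sdiff (fine n M) n μ`
  (the `μ`-row block of `GradOp`), `GradOp_mul_mul_adjoint_apply` (entries of `∂A∂ᴴ` = entries of `∂_μA∂_νᴴ`);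
* **`GradOp_PcT_GradOp_adjoint_apply`**: `(∂·PcT·∂ᴴ)((x,μ),(x′,ν)) = η^{d+1}·dpd n a M μ ν (chart x) (chart x′)` for EVERY `a > 0` —
  r02's matrix entry is `η^{d+1}` times b05's `η`-weighted kernel `dpd` ((1.120)), i.e. the kernel of the record
  `B5Kernel126TorusInstance.K126` read on the typed torus (`distU = tdist/n` under the chart: `distU_eq_tdist`);
* **`norm_GradOp_PcT_GradOp_adjoint_le`** — (1.126) IN p37's HYPOTHESIS SHAPE h126, constants depending on `d` only:
  `∃ δ C, 0 < δ ∧ 0 ≤ C ∧ ∀ n M i j, ‖(∂·PcT·∂ᴴ) i j‖ ≤ C·(n^{d+1})⁻¹·e^{−δ·distU n M i.1 j.1}` (every `k`: `n = L^k ≥ 1`; every volume);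
  `…_le_of_pos` / `…_le_pos`: the same for `M : Fin d → ℕ`, any `d ≥ 1`, weight `(n^d)⁻¹` (no cast at the call site; `0 < C` variant);
* **`holder_GradOp_PcT_GradOp_adjoint`** — (1.127) (and (1.126) once more, one rate `δ′₀` for both, as printed) FOR THE TYPED OPERATOR:
  `‖(∂·PcT·∂ᴴ)((x,μ),(x″,ν)) − (∂·PcT·∂ᴴ)((x′,μ),(x″,ν))‖ ≤ C_α·(n^{d+1})⁻¹·distU(x,x′)^α·e^{−δ′₀·distU(x,x″)}` for `α < 1`, `distU(x,x′) ≤ 1`,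
  transported from r02's PROVED leaf `kernel126_127Printed_torus` through `K126_ker_eq` / `K126_dist_eq` (§5);
* **`K126_ker_eq` / `K126_dist_eq`** — r02's record `B5Kernel126TorusInstance.K126` (for which `B5.Kernel126_127Printed` is PROVED,
  `kernel126_127Printed_torus`) READ ON THE TYPED TORUS: its kernel is `n^{d+1}·Re (∂·PcT·∂ᴴ)((chart⁻¹x, μ),(chart⁻¹x′, ν))` and its
  distance is `distU` — the (1.132) assembly (`B5Transfer132.prop12_of_G0_via132`, `Kd := K126`) now talks about r02's own operator.

HONEST SCOPE.  Dictionary + bookkeeping; the decay is b05's `dpd_decay_uniform_fine` (B4's analyticity method on (1.45)), the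
identification `P ↔ PcT + Pker` is `B5PBridgeProjection`.  Not summit progress.
-/
import Mathlib
import Literature.MathematicalPhysics.QuantumFieldTheory.Balaban1983to89.B5PBridgeProjection
import Literature.MathematicalPhysics.QuantumFieldTheory.Balaban1983to89.B5Kernel126TorusInstance

open scoped BigOperators Matrix ComplexConjugate
open Finset Matrix

namespace Literature.MathematicalPhysics.QuantumFieldTheory.Balaban1983to89.B5PBridgeKernel126

open Literature.MathematicalPhysics.QuantumFieldTheory.Balaban1983to89
open Literature.MathematicalPhysics.QuantumFieldTheory.Balaban1983to89.B5Prop11Plancherel (Tor fine unitVec)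
open Literature.MathematicalPhysics.QuantumFieldTheory.Balaban1983to89.B5Action121 (LapS GradOp sdiff)
open Literature.MathematicalPhysics.QuantumFieldTheory.Balaban1983to89.B5Value126 (PcT)
open Literature.MathematicalPhysics.QuantumFieldTheory.Balaban1983to89.B5Prop12FieldsLattice (distU distSite cdistF)
open Literature.MathematicalPhysics.QuantumFieldTheory.Balaban1983to89.B4Sect5Torus (tdist)
open Literature.MathematicalPhysics.QuantumFieldTheory.Balaban1983to89.B5QGGQ145Bounds (Idx toZ kerRe)
open Literature.MathematicalPhysics.QuantumFieldTheory.Balaban1983to89.B5QGGQ145Factor (KRe QGRe)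
open Literature.MathematicalPhysics.QuantumFieldTheory.Balaban1983to89.B5DPD126Uniform (dpd fup Dmat Dmat_matrixP_Dmat_transpose
  dpd_decay_uniform_fine)
open Literature.MathematicalPhysics.QuantumFieldTheory.Balaban1983to89.B5RowSumsP12Lattice (chartSite tdist_chartSite)
open Literature.MathematicalPhysics.QuantumFieldTheory.Balaban1983to89.B5Kernel126TorusInstance (Index126 K126)
open Literature.MathematicalPhysics.QuantumFieldTheory.Balaban1983to89.B5PBridgeProjection (torIdx torIdx_apply liftC liftC_apply
  liftC_mul liftC_conjTranspose liftC_smul Pfl GradOp_PcT_GradOp_adjoint_eq)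

noncomputable section

variable {d : ℕ} (n : ℕ) [NeZero n] (M : Fin (d + 1) → ℕ) [hM : ∀ μ, NeZero (M μ)]

/-! ## §1 `Dmat` transported is `sdiff`: the chart commutes with the forward step -/

section Step

variable (P : Fin (d + 1) → ℕ) [hP : ∀ i, NeZero (P i)]

/-- the chart takes `x + e_μ` to b05's forward neighbour `fup μ`. [cite: Balaban1984PropagatorsI, (1.4) p.18 (∂_μ)] -/
theorem torIdx_add_unitVec (x : Tor P) (μ : Fin (d + 1)) : torIdx P (x + unitVec P μ) = fup μ (torIdx P x) := by
  funext i
  apply Fin.ext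
  simp only [torIdx_apply, B5RowSumsP12Lattice.chartSite_apply_val, fup]
  by_cases hi : i = μ
  · subst hi
    rw [Function.update_self, Pi.add_apply, unitVec, Pi.single_eq_same, ZMod.val_add, ZMod.val_one_eq_one_mod, Nat.add_mod_mod]
  · rw [Function.update_of_ne hi, Pi.add_apply, unitVec, Pi.single_eq_of_ne hi, add_zero]
    rfl

omit [NeZero n] hM in
/-- **b05's `Dmat μ`, transported, is r02's `∂_μ = sdiff`** (`η = 1/n`). [cite: Balaban1984PropagatorsI, (1.4) p.18]
[cite: Balaban1983RegularityDecay, p.573] -/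
theorem liftC_Dmat (μ : Fin (d + 1)) : liftC (Dmat n P μ) (torIdx P) (torIdx P) = sdiff P (n : ℂ) μ := by
  ext x y
  simp only [liftC_apply, Dmat, Matrix.of_apply, ← torIdx_add_unitVec, (torIdx P).apply_eq_iff_eq, B5Action121.sdiff,
    B5Action121.shiftS, Matrix.smul_apply, Matrix.sub_apply, Matrix.one_apply, smul_eq_mul, @eq_comm _ x y]
  split_ifs <;> push_cast <;> ring

end Step

/-! ## §2 The entries of `∂·PcT·∂ᴴ` are `η^{d+1}·dpd` -/

omit hM in
/-- entries of `∂A∂ᴴ`: `(∂A∂ᴴ)((x,μ),(x′,ν)) = (∂_μ A ∂_νᴴ)(x,x′)`. [cite: Balaban1984PropagatorsI, (1.4) p.18, (1.120) p.37] -/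
theorem GradOp_mul_mul_adjoint_apply [hM : ∀ μ, NeZero (M μ)] (A : Matrix (Tor (fine n M)) (Tor (fine n M)) ℂ)
    (x x' : Tor (fine n M)) (μ ν : Fin (d + 1)) :
    (GradOp (fine n M) (n : ℂ) * A * (GradOp (fine n M) (n : ℂ))ᴴ) (x, μ) (x', ν)
      = (sdiff (fine n M) (n : ℂ) μ * A * (sdiff (fine n M) (n : ℂ) ν)ᴴ) x x' := by
  simp only [Matrix.mul_apply, Matrix.conjTranspose_apply, GradOp]

omit hM in
/-- `∂_μ·Pfl·∂_νᴴ` is b05's `Dmat μ·(KRe·kerRe·QGRe)·(Dmat ν)ᵀ`, transported. [cite: Balaban1984PropagatorsI, p.38 ll.7–10] -/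
theorem sdiff_Pfl_sdiff_adjoint [hM : ∀ μ, NeZero (M μ)] (a : ℝ) (μ ν : Fin (d + 1)) :
    sdiff (fine n M) (n : ℂ) μ * Pfl n M a * (sdiff (fine n M) (n : ℂ) ν)ᴴ
      = liftC (Dmat n (fine n M) μ * (KRe n a M * kerRe n a M * QGRe n a M) * (Dmat n (fine n M) ν)ᵀ)
          (torIdx (fine n M)) (torIdx (fine n M)) := by
  rw [← liftC_Dmat n (fine n M) μ, ← liftC_Dmat n (fine n M) ν, liftC_conjTranspose, Pfl,
    liftC_mul _ _ (torIdx (fine n M)) (torIdx (fine n M)) (torIdx (fine n M)),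
    liftC_mul _ _ (torIdx (fine n M)) (torIdx (fine n M)) (torIdx (fine n M))]

omit hM in
/-- **THE ENTRY IDENTITY**: `(∂·PcT·∂ᴴ)((x,μ),(x′,ν)) = η^{d+1}·dpd n a M μ ν (chart x) (chart x′)` for every `a > 0` — r02's
counting-measure matrix entry is `η^{d+1}` times b05's `η`-weighted kernel ((1.120)), the kernel of `B5Kernel126TorusInstance.K126`.
[cite: Balaban1984PropagatorsI, (1.120) p.37, p.38 ll.7–10, (1.69)–(1.70) pp.29–30] -/
theorem GradOp_PcT_GradOp_adjoint_apply [hM : ∀ μ, NeZero (M μ)] (hn : 1 ≤ n) {a : ℝ} (ha : 0 < a)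
    (x x' : Tor (fine n M)) (μ ν : Fin (d + 1)) :
    (GradOp (fine n M) (n : ℂ) * PcT n M (n : ℂ) * (GradOp (fine n M) (n : ℂ))ᴴ) (x, μ) (x', ν)
      = ((((n : ℝ) ^ (d + 1))⁻¹ * dpd n a M μ ν (torIdx (fine n M) x) (torIdx (fine n M) x') : ℝ) : ℂ) := by
  have hM1 : ∀ i, 1 ≤ M i := fun i => Nat.one_le_iff_ne_zero.mpr (NeZero.ne (M i))
  rw [GradOp_PcT_GradOp_adjoint_eq n M hn ha, GradOp_mul_mul_adjoint_apply, sdiff_Pfl_sdiff_adjoint, liftC_apply,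
    Dmat_matrixP_Dmat_transpose n a hM1, Matrix.smul_apply, smul_eq_mul]

omit hM in
/-- the entries of `∂·PcT·∂ᴴ` are REAL. [cite: Balaban1984PropagatorsI, (1.126) p.38] -/
theorem GradOp_PcT_GradOp_adjoint_im [hM : ∀ μ, NeZero (M μ)] (i j : Tor (fine n M) × Fin (d + 1)) :
    ((GradOp (fine n M) (n : ℂ) * PcT n M (n : ℂ) * (GradOp (fine n M) (n : ℂ))ᴴ) i j).im = 0 := by
  have hn : 1 ≤ n := Nat.one_le_iff_ne_zero.mpr (NeZero.ne n)
  obtain ⟨x, μ⟩ := i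
  obtain ⟨x', ν⟩ := j
  rw [GradOp_PcT_GradOp_adjoint_apply n M hn one_pos, Complex.ofReal_im]

omit hM in
/-- norm form: `‖(∂·PcT·∂ᴴ)((x,μ),(x′,ν))‖ = η^{d+1}·|dpd … (chart x) (chart x′)|`. [cite: Balaban1984PropagatorsI, (1.120) p.37, (1.126) p.38] -/
theorem norm_GradOp_PcT_GradOp_adjoint_apply [hM : ∀ μ, NeZero (M μ)] (hn : 1 ≤ n) {a : ℝ} (ha : 0 < a)
    (x x' : Tor (fine n M)) (μ ν : Fin (d + 1)) :
    ‖(GradOp (fine n M) (n : ℂ) * PcT n M (n : ℂ) * (GradOp (fine n M) (n : ℂ))ᴴ) (x, μ) (x', ν)‖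
      = ((n : ℝ) ^ (d + 1))⁻¹ * |dpd n a M μ ν (torIdx (fine n M) x) (torIdx (fine n M) x')| := by
  rw [GradOp_PcT_GradOp_adjoint_apply n M hn ha, Complex.norm_real, Real.norm_eq_abs, abs_mul,
    abs_of_nonneg (by positivity : (0 : ℝ) ≤ ((n : ℝ) ^ (d + 1))⁻¹)]

/-! ## §3 The distance dictionary and (1.126) in p37's shape -/

omit hM in
/-- `|x − x′|` of (1.109)/(1.126) under the chart: `distU n M x x′ = tdist (chart x) (chart x′)/n`.
[cite: Balaban1984PropagatorsI, (1.109) p.35, (1.126) p.38] -/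
theorem distU_eq_tdist [hM : ∀ μ, NeZero (M μ)] (x x' : Tor (fine n M)) :
    distU n M x x' = tdist (fine n M) (torIdx (fine n M) x) (torIdx (fine n M) x') / n := by
  rw [torIdx_apply, torIdx_apply, tdist_chartSite]
  rfl

/-- **(1.126) FOR r02's TYPED OPERATOR `∂·PcT·∂ᴴ` ON `T_η = Tor (fine n M)`** — p37's hypothesis h126 DISCHARGED, constants depending
on `d` only (b05's `dpd_decay_uniform_fine` at `a = 1`, `PcT` being independent of `a`): for every `n = L^k ≥ 1` (every `k`), every
period vector `M` (every volume) and all bond indices `i = (x,μ)`, `j = (x′,ν)`,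
`‖(∂·PcT·∂ᴴ) i j‖ ≤ C·η^{d+1}·e^{−δ|x−x′|}` (`η^{d+1}`: counting-measure matrix vs. the `η`-weighted kernel of (1.120)).
[cite: Balaban1984PropagatorsI, (1.126) p.38 «The constant O(1) in (1.126) depends on d only», (1.120) p.37; proof supplied by the
audit (b05) along the printed method] -/
theorem norm_GradOp_PcT_GradOp_adjoint_le (d : ℕ) :
    ∃ δ C : ℝ, 0 < δ ∧ 0 ≤ C ∧ ∀ (n : ℕ) [NeZero n] (M : Fin (d + 1) → ℕ) [∀ μ, NeZero (M μ)]
      (i j : Tor (fine n M) × Fin (d + 1)),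
        ‖(GradOp (fine n M) (n : ℂ) * PcT n M (n : ℂ) * (GradOp (fine n M) (n : ℂ))ᴴ) i j‖
          ≤ C * ((n : ℝ) ^ (d + 1))⁻¹ * Real.exp (-(δ * distU n M i.1 j.1)) := by
  obtain ⟨δ, C, hδ, hC, h⟩ := dpd_decay_uniform_fine d 1 1 one_pos
  refine ⟨δ, C, hδ, hC, fun n _ M _ i j => ?_⟩
  have hn : 1 ≤ n := Nat.one_le_iff_ne_zero.mpr (NeZero.ne n)
  have hM1 : ∀ i, 1 ≤ M i := fun i => Nat.one_le_iff_ne_zero.mpr (NeZero.ne (M i))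
  obtain ⟨x, μ⟩ := i
  obtain ⟨x', ν⟩ := j
  rw [norm_GradOp_PcT_GradOp_adjoint_apply n M hn one_pos, mul_comm C, mul_assoc]
  refine mul_le_mul_of_nonneg_left ?_ (by positivity)
  have h' := h n 1 le_rfl le_rfl M hM1 μ ν (torIdx (fine n M) x) (torIdx (fine n M) x')
  rw [distU_eq_tdist, ← mul_div_assoc, mul_div_right_comm]
  exact h'

/-- the same with the quantifiers of b05 (`a ∈ [a₋, a₊]` carried along, for consumers indexing families by `a`).
[cite: Balaban1984PropagatorsI, (1.126) p.38] -/
theorem norm_GradOp_PcT_GradOp_adjoint_le' (d : ℕ) :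
    ∃ δ C : ℝ, 0 < δ ∧ 0 ≤ C ∧ ∀ (n : ℕ) [NeZero n] (M : Fin (d + 1) → ℕ) [∀ μ, NeZero (M μ)]
      (x x' : Tor (fine n M)) (μ ν : Fin (d + 1)),
        ‖(GradOp (fine n M) (n : ℂ) * PcT n M (n : ℂ) * (GradOp (fine n M) (n : ℂ))ᴴ) (x, μ) (x', ν)‖
          ≤ C * ((n : ℝ) ^ (d + 1))⁻¹ * Real.exp (-(δ * distU n M x x')) := by
  obtain ⟨δ, C, hδ, hC, h⟩ := norm_GradOp_PcT_GradOp_adjoint_le d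
  exact ⟨δ, C, hδ, hC, fun n _ M _ x x' μ ν => h n M (x, μ) (x', ν)⟩

/-- **(1.126) for `∂·PcT·∂ᴴ`, ANY DIMENSION `d ≥ 1`** (the form r02/p37/p38 consume: `M : Fin d → ℕ`, weight `(n^d)⁻¹`, no cast at the
call site; `d = d′ + 1` is obtained inside).  [cite: Balaban1984PropagatorsI, (1.126) p.38 «The constant O(1) in (1.126) depends on d
only», (1.120) p.37; proof supplied by the audit (b05)] -/
theorem norm_GradOp_PcT_GradOp_adjoint_le_of_pos {d : ℕ} (hd : 1 ≤ d) :
    ∃ δ C : ℝ, 0 < δ ∧ 0 ≤ C ∧ ∀ (n : ℕ) [NeZero n] (M : Fin d → ℕ) [∀ μ, NeZero (M μ)]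
      (i j : Tor (fine n M) × Fin d),
        ‖(GradOp (fine n M) (n : ℂ) * PcT n M (n : ℂ) * (GradOp (fine n M) (n : ℂ))ᴴ) i j‖
          ≤ C * ((n : ℝ) ^ d)⁻¹ * Real.exp (-(δ * distU n M i.1 j.1)) := by
  obtain ⟨d', rfl⟩ : ∃ d', d = d' + 1 := ⟨d - 1, by omega⟩
  exact norm_GradOp_PcT_GradOp_adjoint_le d'

/-- the same, strictly positive constant `C` (as in `B5.Kernel126_127Printed` / `B5Transfer132.KerBound` consumers' `0 < C`).
[cite: Balaban1984PropagatorsI, (1.126) p.38] -/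
theorem norm_GradOp_PcT_GradOp_adjoint_le_pos {d : ℕ} (hd : 1 ≤ d) :
    ∃ δ C : ℝ, 0 < δ ∧ 0 < C ∧ ∀ (n : ℕ) [NeZero n] (M : Fin d → ℕ) [∀ μ, NeZero (M μ)]
      (i j : Tor (fine n M) × Fin d),
        ‖(GradOp (fine n M) (n : ℂ) * PcT n M (n : ℂ) * (GradOp (fine n M) (n : ℂ))ᴴ) i j‖
          ≤ C * ((n : ℝ) ^ d)⁻¹ * Real.exp (-(δ * distU n M i.1 j.1)) := by
  obtain ⟨δ, C, hδ, hC, h⟩ := norm_GradOp_PcT_GradOp_adjoint_le_of_pos hd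
  refine ⟨δ, C + 1, hδ, by linarith, fun n _ M _ i j => (h n M i j).trans ?_⟩
  gcongr
  linarith

/-! ## §4 b05's kernel and r02's record `K126` read on the typed torus (for the (1.132) assembly) -/

omit hM in
/-- **`dpd` IS `n^{d+1}·Re(∂·PcT·∂ᴴ)` under the inverse chart** (every `a > 0`). [cite: Balaban1984PropagatorsI, (1.120) p.37,
p.38 ll.7–10] -/
theorem dpd_eq_re_GradOp_PcT_GradOp_adjoint [hM : ∀ μ, NeZero (M μ)] (hn : 1 ≤ n) {a : ℝ} (ha : 0 < a)
    (z z' : Idx (fine n M)) (μ ν : Fin (d + 1)) :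
    dpd n a M μ ν z z' = (n : ℝ) ^ (d + 1) *
      ((GradOp (fine n M) (n : ℂ) * PcT n M (n : ℂ) * (GradOp (fine n M) (n : ℂ))ᴴ)
        ((torIdx (fine n M)).symm z, μ) ((torIdx (fine n M)).symm z', ν)).re := by
  have hc : ((n : ℝ) ^ (d + 1)) ≠ 0 := pow_ne_zero _ (Nat.cast_ne_zero.mpr (NeZero.ne n))
  rw [GradOp_PcT_GradOp_adjoint_apply n M hn ha, Equiv.apply_symm_apply, Equiv.apply_symm_apply, Complex.ofReal_re,
    mul_inv_cancel_left₀ hc]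

omit hM in
/-- the fine torus distance in units, under the inverse chart, is `distU`. [cite: Balaban1984PropagatorsI, (1.109) p.35, (1.126) p.38] -/
theorem tdist_div_eq_distU [hM : ∀ μ, NeZero (M μ)] (z z' : Idx (fine n M)) :
    tdist (fine n M) z z' / n = distU n M ((torIdx (fine n M)).symm z) ((torIdx (fine n M)).symm z') := by
  rw [distU_eq_tdist, Equiv.apply_symm_apply, Equiv.apply_symm_apply]

/-- **r02's record `K126`, kernel field, on the typed torus**: for every index `i = (n, a, N, μ, ν)` of the concrete family,
`(K126 i).ker x x′ = n^{d+1}·Re (∂·PcT·∂ᴴ)((chart⁻¹x, μ), (chart⁻¹x′, ν))` with r02's operators on `Tor (fine n N)`.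
[cite: Balaban1984PropagatorsI, (1.120) p.37, (1.126) p.38, (1.132) p.39] -/
theorem K126_ker_eq {aminus aplus : ℝ} (ha : 0 < aminus) (i : Index126 d aminus aplus) (x x' : (K126 aminus aplus i).X) :
    haveI : NeZero i.n := ⟨i.n_pos.ne'⟩
    haveI : ∀ j, NeZero (i.N j) := fun j => ⟨Nat.one_le_iff_ne_zero.mp (i.hN j)⟩
    (K126 aminus aplus i).ker x x' = (i.n : ℝ) ^ (d + 1) *
      ((GradOp (fine i.n i.N) (i.n : ℂ) * PcT i.n i.N (i.n : ℂ) * (GradOp (fine i.n i.N) (i.n : ℂ))ᴴ)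
        ((torIdx (fine i.n i.N)).symm x, i.μ) ((torIdx (fine i.n i.N)).symm x', i.ν)).re := by
  haveI : NeZero i.n := ⟨i.n_pos.ne'⟩
  haveI : ∀ j, NeZero (i.N j) := fun j => ⟨(Nat.one_le_iff_ne_zero.mp (i.hN j))⟩
  exact dpd_eq_re_GradOp_PcT_GradOp_adjoint i.n i.N i.n_pos (lt_of_lt_of_le ha i.ha1) x x' i.μ i.ν

/-- **r02's record `K126`, distance field, on the typed torus**: `(K126 i).dist x x′ = distU (chart⁻¹x) (chart⁻¹x′)` (= `|x − x′|` of
(1.109)/(1.126)). [cite: Balaban1984PropagatorsI, (1.109) p.35, (1.126) p.38] -/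
theorem K126_dist_eq {aminus aplus : ℝ} (i : Index126 d aminus aplus) (x x' : (K126 aminus aplus i).X) :
    haveI : NeZero i.n := ⟨i.n_pos.ne'⟩
    haveI : ∀ j, NeZero (i.N j) := fun j => ⟨Nat.one_le_iff_ne_zero.mp (i.hN j)⟩
    (K126 aminus aplus i).dist x x' = distU i.n i.N ((torIdx (fine i.n i.N)).symm x) ((torIdx (fine i.n i.N)).symm x') := by
  haveI : NeZero i.n := ⟨i.n_pos.ne'⟩
  haveI : ∀ j, NeZero (i.N j) := fun j => ⟨(Nat.one_le_iff_ne_zero.mp (i.hN j))⟩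
  exact tdist_div_eq_distU i.n i.N x x'

/-! ## §5 (1.127) for the typed operator: the Hölder bound of `∂·PcT·∂ᴴ`, transported from r02's PROVED leaf -/

omit hM in
/-- real entries: `E = (Re E : ℂ)`. [cite: Balaban1984PropagatorsI, (1.126) p.38] -/
theorem GradOp_PcT_GradOp_adjoint_eq_ofReal_re [hM : ∀ μ, NeZero (M μ)] (i j : Tor (fine n M) × Fin (d + 1)) :
    (GradOp (fine n M) (n : ℂ) * PcT n M (n : ℂ) * (GradOp (fine n M) (n : ℂ))ᴴ) i j
      = ((((GradOp (fine n M) (n : ℂ) * PcT n M (n : ℂ) * (GradOp (fine n M) (n : ℂ))ᴴ) i j).re : ℝ) : ℂ) :=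
  Complex.ext (by simp) (by simp [GradOp_PcT_GradOp_adjoint_im n M i j])

/-- **(1.127) FOR r02's TYPED OPERATOR `∂·PcT·∂ᴴ`** (with (1.126) once more, ONE rate `δ′₀` for both, as printed): for `α < 1` and
`|x − x′| ≤ 1`, `‖(∂·PcT·∂ᴴ)((x,μ),(x″,ν)) − (∂·PcT·∂ᴴ)((x′,μ),(x″,ν))‖ ≤ C_α·η^{d+1}·|x − x′|^α·e^{−δ′₀|x − x″|}` — r02's PROVED leaf
`B5Kernel126TorusInstance.kernel126_127Printed_torus` (the abstract `B5.Kernel126_127Printed` inhabited for `K126`) read through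
`K126_ker_eq` / `K126_dist_eq`; constants depend on `d` (and `α`) only («in (1.127) it depends on α also (O(1) → ∞ if α → 1)»).
[cite: Balaban1984PropagatorsI, (1.126)–(1.127) p.38; proof supplied by the audit (r02/b05) along the printed method] -/
theorem holder_GradOp_PcT_GradOp_adjoint (d : ℕ) :
    ∃ δ C : ℝ, ∃ Cα : ℝ → ℝ, 0 < δ ∧ 0 < C ∧ ∀ (n : ℕ) [NeZero n] (M : Fin (d + 1) → ℕ) [∀ μ, NeZero (M μ)]
      (μ ν : Fin (d + 1)),
      (∀ x x' : Tor (fine n M),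
        ‖(GradOp (fine n M) (n : ℂ) * PcT n M (n : ℂ) * (GradOp (fine n M) (n : ℂ))ᴴ) (x, μ) (x', ν)‖
          ≤ C * ((n : ℝ) ^ (d + 1))⁻¹ * Real.exp (-(δ * distU n M x x'))) ∧
      (∀ (α : ℝ) (x x' x'' : Tor (fine n M)), α < 1 → distU n M x x' ≤ 1 →
        ‖(GradOp (fine n M) (n : ℂ) * PcT n M (n : ℂ) * (GradOp (fine n M) (n : ℂ))ᴴ) (x, μ) (x'', ν)
            - (GradOp (fine n M) (n : ℂ) * PcT n M (n : ℂ) * (GradOp (fine n M) (n : ℂ))ᴴ) (x', μ) (x'', ν)‖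
          ≤ Cα α * ((n : ℝ) ^ (d + 1))⁻¹ * distU n M x x' ^ α * Real.exp (-(δ * distU n M x x''))) := by
  obtain ⟨δ, C, Cα, hδ, hC, h⟩ := B5Kernel126TorusInstance.kernel126_127Printed_torus d 1 1 one_pos
  refine ⟨δ, C, Cα, hδ, hC, fun n _ M _ μ ν => ?_⟩
  have hM1 : ∀ i, 1 ≤ M i := fun i => Nat.one_le_iff_ne_zero.mpr (NeZero.ne (M i))
  have hnpos : (0 : ℝ) < (n : ℝ) ^ (d + 1) := pow_pos (Nat.cast_pos.mpr (NeZero.pos n)) _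
  have hninv : (0 : ℝ) < ((n : ℝ) ^ (d + 1))⁻¹ := inv_pos.mpr hnpos
  -- the index of the concrete family; its carrier IS `Idx (fine n M)`
  let ι : Index126 d 1 1 := ⟨n, NeZero.pos n, 1, le_rfl, le_rfl, M, hM1, μ, ν⟩
  have hker : ∀ x x' : Tor (fine n M), (K126 1 1 ι).ker (torIdx (fine n M) x) (torIdx (fine n M) x')
      = (n : ℝ) ^ (d + 1) * ((GradOp (fine n M) (n : ℂ) * PcT n M (n : ℂ) * (GradOp (fine n M) (n : ℂ))ᴴ)
          (x, μ) (x', ν)).re := fun x x' => by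
    rw [K126_ker_eq one_pos ι (torIdx (fine n M) x) (torIdx (fine n M) x')]
    show (n : ℝ) ^ (d + 1) * ((GradOp (fine n M) (n : ℂ) * PcT n M (n : ℂ) * (GradOp (fine n M) (n : ℂ))ᴴ)
        ((torIdx (fine n M)).symm (torIdx (fine n M) x), μ) ((torIdx (fine n M)).symm (torIdx (fine n M) x'), ν)).re = _
    rw [Equiv.symm_apply_apply, Equiv.symm_apply_apply]
  have hdist : ∀ x x' : Tor (fine n M), (K126 1 1 ι).dist (torIdx (fine n M) x) (torIdx (fine n M) x') = distU n M x x' :=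
    fun x x' => by
    rw [K126_dist_eq ι (torIdx (fine n M) x) (torIdx (fine n M) x')]
    show distU n M ((torIdx (fine n M)).symm (torIdx (fine n M) x)) ((torIdx (fine n M)).symm (torIdx (fine n M) x')) = _
    rw [Equiv.symm_apply_apply, Equiv.symm_apply_apply]
  obtain ⟨h1, h2⟩ := h ι
  refine ⟨fun x x' => ?_, fun α x x' x'' hα hxx' => ?_⟩
  · -- (1.126) once more, from the leaf
    have h1' := h1 (torIdx (fine n M) x) (torIdx (fine n M) x')
    rw [hker, hdist, abs_mul, abs_of_pos hnpos] at h1'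
    rw [GradOp_PcT_GradOp_adjoint_eq_ofReal_re n M, Complex.norm_real, Real.norm_eq_abs]
    have := mul_le_mul_of_nonneg_left h1' hninv.le
    rw [← mul_assoc, inv_mul_cancel₀ hnpos.ne', one_mul] at this
    refine this.trans_eq ?_
    ring
  · -- (1.127)
    have h2' := h2 α (torIdx (fine n M) x) (torIdx (fine n M) x') (torIdx (fine n M) x'') hα (by rw [hdist]; exact hxx')
    rw [hker, hker, hdist, hdist, ← mul_sub, abs_mul, abs_of_pos hnpos] at h2'
    rw [GradOp_PcT_GradOp_adjoint_eq_ofReal_re n M (x, μ), GradOp_PcT_GradOp_adjoint_eq_ofReal_re n M (x', μ),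
      ← Complex.ofReal_sub, Complex.norm_real, Real.norm_eq_abs]
    have := mul_le_mul_of_nonneg_left h2' hninv.le
    rw [← mul_assoc, inv_mul_cancel₀ hnpos.ne', one_mul] at this
    refine this.trans_eq ?_
    ring

end

end Literature.MathematicalPhysics.QuantumFieldTheory.Balaban1983to89.B5PBridgeKernel126
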